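/-
Copyright (c) 2026. All rights reserved.
Released under Apache 2.0 license as described in the file LICENSE.
Authors: abc-iut cell — seat abc-iut-w5-d058 (wave 5; §4(iii) non-vacuity programme, layer L4: the [AbsTopII] §3
cuspidalization MODEL records at the empty model / empty class).
-/
import Literature.AnabelianGeometry.AbsoluteAnabelian.AbsTopII.EllipticAdmissible
import Literature.AnabelianGeometry.AbsoluteAnabelian.AbsTopII.BelyiCuspidalization
import Literature.AnabelianGeometry.AbsoluteAnabelian.AbsTopII.EllipticCuspidalizationComparison
import HarnessLib

/-!
# [AbsTopII] §3 model records `IsogenyModel`, `BelyiCurveModel`, `BelyiModel 𝒟`, `EllipticModel 𝒟`: the empty witnesses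

S. Mochizuki, *Topics in absolute anabelian geometry II* [MochizukiAbsTopII2013], §3: Cor 3.3 pp. 67–69, Cor 3.4 pp. 69–70,
Cor 3.7 pp. 72–73, Cor 3.8 p. 74 (elliptic and Belyi cuspidalization).

abc-iut-w5-d197's INHABITATION-CENSUS-L4 v1 (04:2xZ) lists the MODEL records over which the cell types the [AbsTopII] §3
comparison facts — `AbsTopII.IsogenyModel`, `AbsTopII.BelyiCurveModel`, `AbsTopII.BelyiModel`, `AbsTopII.EllipticModel`
— with ZERO kernel producers.  PROOF-ONLY file (no `def` / `instance` / `structure`), honest labels: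

* `IsogenyModel.exists_empty` — the model with NO curves inhabits `IsogenyModel`, and `AbsTopII.Cor_3_3_ii` holds for
  it VACUOUSLY;
* `BelyiCurveModel.exists_empty` — likewise, with `Cor_3_7 ∧ Cor_3_8` vacuous;
* `BelyiModel.exists_over_emptyClass` / `EllipticModel.exists_over_emptyClass` — over the EMPTY class of construction
  data (`AbsTopI.ConstructionDataClass` with no base field, cf. `GaloisTheatersNonVacuity.lean`), the records are
  inhabited and ALL of `BelyiModel.Cor_3_7`, `BelyiModel.Cor_3_8`, `EllipticModel.Cor_3_3_i/ii/iii`, `EllipticModel.Cor_3_4`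
  hold VACUOUSLY, together with the class hypotheses `IsChainFull ∧ RelIsomDGC ∧ RelHomDGC`.

HONEST LABEL: EMPTY models — these witnesses show only that the record types are inhabited and that the model-relative
named facts of [AbsTopII] §3 are jointly satisfiable AS TYPED (vacuously); they say nothing about curves and are NOT
discharges (the facts stay fact-open / reduced-to-Ex 4.8 (i) at the intended étale-`π₁` model, FOUNDATIONS row 12).
Nothing of [AbsTopII] is asserted; instantiated ≠ endorsed; nothing here bears on the disputed [IUTchIII] Cor. 3.12.
-/

noncomputable section

namespace Literature.AnabelianGeometry.AbsoluteAnabelian.AbsTopII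

open CategoryTheory
open AbsTopI (ConstructionDataClass)

universe u

/-- **The isogeny model with no curves**; `Cor_3_3_ii` (the group-theoretic characterisation of the semi-elliptic
double coverings, relative to the model) holds for it VACUOUSLY. [cite: MochizukiAbsTopII2013, Cor 3.3 (ii) p.68] -/
theorem IsogenyModel.exists_empty :
    ∃ M : IsogenyModel.{u}, IsEmpty M.Curve ∧ Cor_3_3_ii M :=
  ⟨{ Curve := PEmpty.{u + 1}
     ext := fun X => X.elim
     FinEt := fun X => X.elim
     extMap := fun {Y} => Y.elim
     extMap_isOpenInjective := fun {Y} => Y.elim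
     IsScheme := fun X => X.elim
     genus := fun X => X.elim
     cuspCard := fun X => X.elim
     IsDefinedOverNF := fun X => X.elim }, inferInstanceAs (IsEmpty PEmpty), fun C => C.elim⟩

/-- **The Belyi-curve model with no curves**; `Cor_3_7 ∧ Cor_3_8` hold for it VACUOUSLY.
[cite: MochizukiAbsTopII2013, Cor 3.7 pp.72-73] -/
theorem BelyiCurveModel.exists_empty :
    ∃ M : BelyiCurveModel.{u}, IsEmpty M.Curve ∧ M.Cor_3_7 ∧ M.Cor_3_8 :=
  ⟨{ Curve := PEmpty.{u + 1}
     ext := fun X => X.elim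
     FinEt := fun X => X.elim
     extMap := fun {Y} => Y.elim
     extMap_isOpenInjective := fun {Y} => Y.elim
     IsScheme := fun X => X.elim
     genus := fun X => X.elim
     cuspCard := fun X => X.elim
     IsDefinedOverNF := fun X => X.elim
     base := fun X => X.elim
     instField := fun X => X.elim
     instCharZero := fun X => X.elim
     galIso := fun X => X.elim
     Open := fun X => X.elim
     cuspOf := fun {X} => X.elim
     cuspsOf := fun {X} => X.elim }, inferInstanceAs (IsEmpty PEmpty), fun X => X.elim, fun X => X.elim⟩

/-- **The Belyi model over the EMPTY class of construction data**: inhabited, the class is chain-full with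
rel-isom-DGC and rel-hom-DGC, and `Cor_3_7 ∧ Cor_3_8` hold — all VACUOUSLY. [cite: MochizukiAbsTopII2013, Cor 3.7 pp.72-73] -/
theorem BelyiModel.exists_over_emptyClass :
    ∃ (𝒟 : ConstructionDataClass.{u}) (M : BelyiModel 𝒟), IsEmpty 𝒟.Base ∧
      𝒟.IsChainFull ∧ 𝒟.RelIsomDGC ∧ 𝒟.RelHomDGC ∧ M.Cor_3_7 ∧ M.Cor_3_8 :=
  ⟨{ Base := PEmpty.{u + 1}
     fld := fun b => b.elim
     instField := fun b => b.elim
     instCharZero := fun b => b.elim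
     datum := fun b => b.elim
     Mem := fun b => b.elim
     IsHyperbolicOrbicurve := fun b => b.elim
     isHyperbolicOrbicurve_of_isHyperbolicCurve := fun b => b.elim
     chainTerms := fun b => b.elim },
   { cusps := fun b => b.elim
     IsStrictlyBelyiType := fun b => b.elim
     NFOpen := fun b => b.elim
     cuspOf := fun {b} => b.elim
     cuspsOf := fun {b} => b.elim },
   inferInstanceAs (IsEmpty PEmpty), fun b => b.elim, fun b => b.elim, fun b => b.elim,
   fun _ _ b => b.elim, fun _ _ b => b.elim⟩

/-- **The elliptic model over the EMPTY class of construction data**: inhabited, the class hypotheses hold, and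
`Cor_3_3_i ∧ Cor_3_3_ii ∧ Cor_3_3_iii ∧ Cor_3_4` hold — all VACUOUSLY. [cite: MochizukiAbsTopII2013, Cor 3.3 pp.67-69] -/
theorem EllipticModel.exists_over_emptyClass :
    ∃ (𝒟 : ConstructionDataClass.{u}) (M : EllipticModel 𝒟), IsEmpty 𝒟.Base ∧
      𝒟.IsChainFull ∧ 𝒟.RelIsomDGC ∧ 𝒟.RelHomDGC ∧
      M.Cor_3_3_i ∧ M.Cor_3_3_ii ∧ M.Cor_3_3_iii ∧ M.Cor_3_4 :=
  ⟨{ Base := PEmpty.{u + 1}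
     fld := fun b => b.elim
     instField := fun b => b.elim
     instCharZero := fun b => b.elim
     datum := fun b => b.elim
     Mem := fun b => b.elim
     IsHyperbolicOrbicurve := fun b => b.elim
     isHyperbolicOrbicurve_of_isHyperbolicCurve := fun b => b.elim
     chainTerms := fun b => b.elim },
   { cusps := fun b => b.elim
     IsEllipticallyAdmissible := fun b => b.elim
     coreExt := fun b => b.elim
     toCore := fun b => b.elim
     toCore_isOpenInjective := fun b => b.elim
     toCore_gal_bijective := fun b => b.elim
     doubleCovers := fun b => b.elim
     Setting := fun b => b.elim
     PiD := fun {b} => b.elim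
     PiD_mem := fun {b} => b.elim
     galOpen := fun {b} => b.elim
     normal_galOpen := fun {b} => b.elim
     isOpen_galOpen := fun {b} => b.elim
     level := fun {b} => b.elim
     level_isSigmaInteger := fun {b} => b.elim
     PiV := fun {b} => b.elim
     normal_PiV := fun {b} => b.elim
     isOpen_PiV := fun {b} => b.elim
     PiV_le := fun {b} => b.elim
     map_PiV_le := fun {b} => b.elim
     cuspUX := fun {b} => b.elim
     proSet_geom_cuspUX := fun {b} => b.elim
     cuspsUX := fun {b} => b.elim },
   inferInstanceAs (IsEmpty PEmpty), fun b => b.elim, fun b => b.elim, fun b => b.elim,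
   fun _ _ b => b.elim, fun _ _ b => b.elim, fun _ _ b => b.elim, fun _ _ b => b.elim⟩

end Literature.AnabelianGeometry.AbsoluteAnabelian.AbsTopII

end
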